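import Summits.BirchSwinnertonDyer.BirchSwinnertonDyer.Theorems.KimAtThreePortSharedC2Supply
import HarnessLib

/-!
# ONE unit minus modular symbol per row at ANY level, from surj(3) alone — the (C2′) certificate of the
# Kolyvagin-system road off the additive locus (cell `bsd-addord`, seat w2-c3 gen 6; route W2
# `KimAtThreeKolyvagin`, crux 19076 `DeepUpperAtThree`, child 19562 — its non-additive rows)

HONEST FRAMING: theorems only (no definition, no named fact, no `sorry`); nothing is booked; BSD is not proved.

## What, and why

This seat's `KimAtThreeDeepUpperNonAdditiveAllOfFineKato` (p484461) proves 19562's registered stub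
`stub_nonAdditive` VERBATIM from S24-DEEP ×2 + GZK + PT + (C1₃) + (C2₃′), where (C2₃′) is the CERTIFICATE
SUPPLY off the additive locus: Kato's auxiliary datum `(c, d, a, A, d′, aM)` with the usual guards, the cusp
certificate `v₃(R⁻) = 0` and the depletion certificate `v₃(∏_{q∣3A}E_q(1)) = α − 1` for some `α : ℕ`.
Its Kato-stratum twin (C2)/(C2′) is a THEOREM (gen 4 `unitMinusSymbol_classwide`, kim3
`certSupply_row_of_unitMinusSymbol`), but both used the additive prime: the Chebotarev progression step
needed `3 ∣ N ∣ γ` (to force `q ≡ δ ≡ 2 (mod 3)`), the Euler-product step `9 ∣ N` (`a₃ = 0`).  This file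
removes the first use (the companion `KimAtThreeDeepUpperCertSupplyNonAdditive` the second):
* `unitMinusSymbol_row_of_progression₃` — Chebotarev class modulo `3|γ|` (needs only `3 ∤ δ`);
* `unitMinusSymbol_row₃` — ONE unit minus symbol `[a₀/q]⁻` at a non-anomalous good prime `q ≡ 2 (mod 3)`,
  `q ∤ N`, for EVERY `W` with `ρ̄_{E,3}` onto and EVERY datum `P`, any level (re-parametrise Manin's
  progression so that `δ ≡ 2 (mod 3)`).
References: [Manin1972] Prop. 1.4 / Thm. 1.6; [TateGCFT1967] §2.4; [Kato2004Asterisque] Thm. 6.6 (1), Ex. 13.3;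
[SilvermanAEC2009] Thm. V.1.1, Ex. 8.19 (a); gen-4 memo W2C3-C2PRIME-CLASSWIDE-g4.md.
-/

-- the cell's Theorems namespace repeats the summit name by design (D-0017)
set_option linter.dupNamespace false

noncomputable section

open scoped NumberField TensorProduct Classical MatrixGroups
open Field Finset IsDedekindDomain NumberField WeierstrassCurve Rat.HeightOneSpectrum
open Literature.NumberTheory.GaloisRepresentations Literature.NumberTheory.GaloisCohomology
open Literature.NumberTheory.GaloisRepresentations.DiscreteGaloisModule
open Literature.NumberTheory.EllipticCurves Literature.NumberTheory.EllipticCurves.ModularForms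
open Literature.NumberTheory.EllipticCurves.Rank1Residual
open Literature.NumberTheory.EllipticCurves.Kato2004
open Literature.NumberTheory.EllipticCurves.Kato2004.EulerSystemValues
open Summit.BirchSwinnertonDyer.Rank1Residual.GaloisImage
open Summit.BirchSwinnertonDyer.BirchSwinnertonDyer.Theorems
open Summit.BirchSwinnertonDyer.BirchSwinnertonDyer.Theorems.KimAtThreeKolyvaginPortSharedCert

namespace Summit.BirchSwinnertonDyer.BirchSwinnertonDyer.Theorems.KimAtThreeDeepUpperUnitMinusSymbolAnyLevel

/-! ### §1 One unit minus symbol per row, any level -/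

/-- **(C2′) at a row from a progression of unit cusps with `δ ≡ 2 (mod 3)` — ANY level (`3 ∣ γ` NOT
required)**: gen 4's `unitMinusSymbol_row_of_progression` with the Chebotarev class taken modulo `3|γ|`
instead of `|γ|` (`gcd(3γ, δ) = 1` from `gcd(γ, δ) = 1` and `3 ∤ δ`), so that the supplied good prime
`q = γk + δ > max(N, 2)` with `3 ∤ a_q(W) − (q+1)` is `≡ δ ≡ 2 (mod 3)` whatever `γ` is; `a_q(P.f) = a_q(W)`
and `[(αk+β)/q]⁻ = 1/2` as there. [cite: TateGCFT1967, §2.4 (Tchebotarev density theorem)]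
[cite: Manin1972, Prop. 1.4  Thm. 1.6] [cite: SilvermanAEC2009, Exercise 8.19(a) (p. 230)] -/
theorem unitMinusSymbol_row_of_progression₃ (W : WeierstrassCurve ℚ) [W.IsElliptic] [W.IsGloballyMinimal]
    (hs : W.HasSurjectiveModNGaloisRep (3 : ℕ)) {N : ℕ} [NeZero N] (P : ModularParametrizationData W N)
    {α β γ δ : ℤ} (hγ0 : γ ≠ 0) (hcop : IsCoprime γ δ) (hδ : δ % 3 = 2)
    (hprog : ∀ k : ℤ, γ * k + δ ≠ 0 →
      ratMinusSymbol P.f (((α * k + β : ℤ) : ℚ) / ((γ * k + δ : ℤ) : ℚ)) = 1 / 2) :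
    ∃ (q n : ℕ) (t a₀ : ℤ), q.Prime ∧ q % 3 = 2 ∧ ¬ q ∣ N ∧ 1 ≤ n ∧
      cuspCoeff P.f q = t ∧ ¬ (3 : ℤ) ∣ (q : ℤ) + 1 - t ∧
      ratMinusSymbol P.f ((a₀ : ℚ) / ((q ^ n : ℕ) : ℚ)) ≠ 0 ∧
      padicValRat 3 (ratMinusSymbol P.f ((a₀ : ℚ) / ((q ^ n : ℕ) : ℚ))) = 0 := by
  haveI : Fact (Nat.Prime 3) := ⟨Nat.prime_three⟩
  -- the modulus `M = 3|γ|` and the unit `δ mod M` (`gcd(γ, δ) = 1`, `3 ∤ δ`)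
  set M : ℕ := 3 * γ.natAbs with hM
  haveI : NeZero M := ⟨mul_ne_zero three_ne_zero (Int.natAbs_ne_zero.mpr hγ0)⟩
  have hγM' : (γ.natAbs : ℤ) ∣ (M : ℤ) := ⟨3, by rw [hM]; push_cast; ring⟩
  have h3M' : (3 : ℤ) ∣ (M : ℤ) := ⟨γ.natAbs, by rw [hM]; push_cast; ring⟩
  have h3δ : ¬ (3 : ℤ) ∣ δ := by omega
  have hcop3 : IsCoprime (3 * γ) δ :=
    IsCoprime.mul_left (Int.prime_three.irreducible.coprime_iff_not_dvd.mpr h3δ) hcop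
  have hMγ3 : (M : ℤ) ∣ 3 * γ := by
    rw [hM]; push_cast
    exact mul_dvd_mul_left 3 (abs_dvd_self γ)
  have hγM : ((3 * γ : ℤ) : ZMod M) = 0 := (ZMod.intCast_zmod_eq_zero_iff_dvd (3 * γ) M).mpr hMγ3
  have hu : IsUnit ((δ : ℤ) : ZMod M) := by
    obtain ⟨a, b, hab⟩ := hcop3
    have h1 : ((b : ℤ) : ZMod M) * ((δ : ℤ) : ZMod M) = 1 := by
      have := congrArg (fun z : ℤ => ((z : ℤ) : ZMod M)) hab
      simp only [Int.cast_add, Int.cast_mul, Int.cast_one, hγM, mul_zero, zero_add] at this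
      exact this
    exact IsUnit.of_mul_eq_one_right _ h1
  -- the excluded primes: everything `≤ max N 2`
  set S : Set ℕ := {ℓ | ℓ ≤ max N 2} with hSdef
  have hS : S.Finite := Set.finite_le_nat _
  obtain ⟨q, hqF, hqS, -, hgood, hqu, htr⟩ :=
    KimAtThreePortSharedC2Chebotarev.exists_prime_cast_eq_not_dvd_frobeniusTrace_sub_of_surj W hs M
      hu.unit S hS
  have hq : q.Prime := hqF.out
  have hqmax : max N 2 < q := by
    by_contra h
    exact hqS (Set.mem_setOf.mpr (not_lt.mp h))
  have hqN : ¬ q ∣ N := fun h =>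
    (lt_of_le_of_lt (le_max_left N 2) hqmax).not_ge (Nat.le_of_dvd (Nat.pos_of_neZero N) h)
  -- `q ≡ δ (mod γ)`: `q = γ k + δ`
  have hqδ : ((q : ℤ) : ZMod M) = ((δ : ℤ) : ZMod M) := by
    rw [Int.cast_natCast, hqu, IsUnit.unit_spec]
  have hMdvd : (M : ℤ) ∣ (q : ℤ) - δ := (ZMod.intCast_eq_intCast_iff_dvd_sub δ (q : ℤ) M).mp hqδ.symm
  have hdvd : γ ∣ (q : ℤ) - δ := Int.natAbs_dvd.mp (dvd_trans hγM' hMdvd)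
  obtain ⟨k, hk⟩ := hdvd
  have hqk : (q : ℤ) = γ * k + δ := by linear_combination hk
  -- `q ≡ δ ≡ 2 (mod 3)`
  have hq3 : q % 3 = 2 := by
    obtain ⟨g', hg'⟩ := dvd_trans h3M' hMdvd
    have h1 : (q : ℤ) = 3 * g' + δ := by linear_combination hg'
    omega
  -- the trace and the coefficient
  have hcoeff : cuspCoeff P.f q = ((W.frobeniusTrace q : ℤ) : ℂ) := by
    rw [P.isNewformOf.2 q, WeierstrassCurve.LFunction_apply_prime_eq_frobeniusTrace W q hgood]
  have h3t : ¬ (3 : ℤ) ∣ (q : ℤ) + 1 - W.frobeniusTrace q := by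
    intro h
    apply htr
    have : W.frobeniusTrace q - ((q : ℤ) + 1) = -((q : ℤ) + 1 - W.frobeniusTrace q) := by ring
    rw [this]
    exact (dvd_neg).mpr h
  -- the unit minus symbol at `(αk+β)/q`
  have hkq : γ * k + δ ≠ 0 := by
    rw [← hqk]; exact_mod_cast hq.ne_zero
  have hsym : ratMinusSymbol P.f (((α * k + β : ℤ) : ℚ) / ((q ^ 1 : ℕ) : ℚ)) = 1 / 2 := by
    have h := hprog k hkq
    have hcast : ((γ * k + δ : ℤ) : ℚ) = ((q ^ 1 : ℕ) : ℚ) := by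
      rw [pow_one, ← hqk, Int.cast_natCast]
    rwa [hcast] at h
  refine ⟨q, 1, W.frobeniusTrace q, α * k + β, hq, hq3, hqN, le_rfl, hcoeff, h3t, ?_, ?_⟩
  · rw [hsym]; norm_num
  · rw [hsym, padicValRat.div one_ne_zero two_ne_zero, padicValRat.one]
    have h2 : padicValRat 3 (2 : ℚ) = 0 := by
      have h := @padicValRat.of_nat 3 2
      rw [Nat.cast_ofNat] at h
      rw [h, padicValNat.eq_zero_of_not_dvd (by norm_num)]
      simp
    rw [h2, sub_zero]

/-- **(C2′) at a row, from surj(3) ALONE — any level `N`** (gen 4's `unitMinusSymbol_row` needed `3 ∣ N`):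
Manin's progression `(αk+β)/(γk+δ)` of cusps with `[·]⁻ = 1/2` (`N ∣ γ ≠ 0`, `αδ − βγ = 1`) is
re-parametrised so that `δ ≡ 2 (mod 3)` — negate all four integers if `δ ≡ 1`, shift `k ↦ k + j` (so
`δ ↦ δ + γj`, `β ↦ β + αj`) if `δ ≡ 0` (then `3 ∤ γ`) — and fed to `unitMinusSymbol_row_of_progression₃`.
[cite: Manin1972, Prop. 1.4  Thm. 1.6] [cite: TateGCFT1967, §2.4 (Tchebotarev density theorem)] -/
theorem unitMinusSymbol_row₃ (W : WeierstrassCurve ℚ) [W.IsElliptic] [W.IsGloballyMinimal]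
    (hs : W.HasSurjectiveModNGaloisRep (3 : ℕ)) {N : ℕ} [NeZero N]
    (P : ModularParametrizationData W N) :
    ∃ (q n : ℕ) (t a₀ : ℤ), q.Prime ∧ q % 3 = 2 ∧ ¬ q ∣ N ∧ 1 ≤ n ∧
      cuspCoeff P.f q = t ∧ ¬ (3 : ℤ) ∣ (q : ℤ) + 1 - t ∧
      ratMinusSymbol P.f ((a₀ : ℚ) / ((q ^ n : ℕ) : ℚ)) ≠ 0 ∧
      padicValRat 3 (ratMinusSymbol P.f ((a₀ : ℚ) / ((q ^ n : ℕ) : ℚ))) = 0 := by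
  have hf : IsNewform0 P.f := P.isNewformOf.1
  have hQ : coeffField P.f = ⊥ := IsNewformOf.coeffField_eq_bot_of_isNewformOf P.isNewformOf
  have hreal : ∀ n, (cuspCoeff P.f n).im = 0 := fun n => by
    rw [P.isNewformOf.2 n]; exact Complex.intCast_im _
  obtain ⟨α, β, γ, δ, -, hγ0, hdet, hprog⟩ :=
    KimAtThreePortSharedC2MinusSymbol.exists_progression_ratMinusSymbol_eq_half hf hQ hreal
  have hcop : IsCoprime γ δ := ⟨-β, α, by linear_combination hdet⟩
  -- the three residues of `δ mod 3`
  have hδ : δ % 3 = 0 ∨ δ % 3 = 1 ∨ δ % 3 = 2 := by omega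
  rcases hδ with hδ0 | hδ1 | hδ2
  · -- `3 ∣ δ`, hence `3 ∤ γ`: shift the progression by `j` with `γ j ≡ 2 (mod 3)`
    have h3γ : ¬ (3 : ℤ) ∣ γ := by
      rintro ⟨g', hg'⟩
      obtain ⟨d', hd'⟩ := Int.dvd_of_emod_eq_zero hδ0
      have h : (3 : ℤ) ∣ 1 := ⟨α * d' - β * g', by rw [← hdet, hg', hd']; ring⟩
      norm_num at h
    obtain ⟨j, hj⟩ : ∃ j : ℤ, (δ + γ * j) % 3 = 2 := by
      have hγ : γ % 3 = 1 ∨ γ % 3 = 2 := by omega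
      rcases hγ with h | h
      · exact ⟨2, by omega⟩
      · exact ⟨1, by omega⟩
    have hcop' : IsCoprime γ (δ + γ * j) := by
      obtain ⟨a, b, hab⟩ := hcop
      exact ⟨a - b * j, b, by linear_combination hab⟩
    refine unitMinusSymbol_row_of_progression₃ W hs P (α := α) (β := β + α * j) (γ := γ)
      (δ := δ + γ * j) hγ0 hcop' hj fun k hk => ?_
    have hk' : γ * (k + j) + δ ≠ 0 := by intro h; apply hk; linear_combination h
    have h := hprog (k + j) hk'
    have hcast : ((α * k + (β + α * j) : ℤ) : ℚ) / ((γ * k + (δ + γ * j) : ℤ) : ℚ) =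
        ((α * (k + j) + β : ℤ) : ℚ) / ((γ * (k + j) + δ : ℤ) : ℚ) := by
      push_cast; ring_nf
    rw [hcast]; exact h
  · -- negate all four integers: same cusps, `−δ ≡ 2 (mod 3)`
    refine unitMinusSymbol_row_of_progression₃ W hs P (α := -α) (β := -β) (γ := -γ) (δ := -δ)
      (neg_ne_zero.mpr hγ0) hcop.neg_neg (by omega) fun k hk => ?_
    have hk' : γ * k + δ ≠ 0 := by
      intro h; apply hk; linear_combination -h
    have h := hprog k hk'
    have hcast : ((-α * k + -β : ℤ) : ℚ) / ((-γ * k + -δ : ℤ) : ℚ) =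
        ((α * k + β : ℤ) : ℚ) / ((γ * k + δ : ℤ) : ℚ) := by
      push_cast
      rw [show -(α : ℚ) * k + -(β : ℚ) = -((α : ℚ) * k + β) by ring,
        show -(γ : ℚ) * k + -(δ : ℚ) = -((γ : ℚ) * k + δ) by ring, neg_div_neg_eq]
    rw [hcast]; exact h
  · exact unitMinusSymbol_row_of_progression₃ W hs P hγ0 hcop hδ2 hprog

end Summit.BirchSwinnertonDyer.BirchSwinnertonDyer.Theorems.KimAtThreeDeepUpperUnitMinusSymbolAnyLevel

end
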